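import Literature.Computability.QuantumComplexity.GuessedOracleRuns
import HarnessLib

/-!
# Guessed walks of Clifford+`T` circuits whose oracle gates carry their OWN languages

Toolkit file (`Literature/Computability/QuantumComplexity`), the per-gate-oracle form of
`GuessedOracleRuns.lean`. There the pair counts `annSetA`/`annSetB` of `OraclePathSums.lean`
relative to ONE oracle `A` annotating every gate (`gs.map (·, A)`) are rewritten as sums over pairs
of `A`-consistent GUESSED coin strings of the total walk `ADH.tRunO` (one coin per gate; at an
oracle gate the coin is the guessed answer bit). The replaced circuits of Aaronson–Chen's Lemma 5.3
(CCC 2017, §5.3, p. 22: "we replaced the `f_{n_i}` gate with a `g_i` gate"; the tree's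
`AcSim.tabRun`, `Literature/Barriers/QuantumAdvantage/AaronsonChenTables.lean`) are annotated gate
lists whose oracle gates carry DIFFERENT languages `TQBF ⊕ (O ∩ K_t)` (the knowledge `K_t` grows
with `t`), so the single-oracle form does not apply; this file redoes the reindexing for an
arbitrary annotated list `gas : List (AnnGate N)`:

* `annotate As gs` — the list `gs` with gate `t` annotated by `As t`; `ConsG gas cs w` (every
  guess is the answer of the gate's own language), `fillG` (fill in the own answers);
* `consG_fillG`, `clearO_fillG`, `fillG_clearO`, `annPathRun_eq_none_of_not_isClear'`,
  **`tRunO_fillG_spec`** (the guessed walk with the own answers filled in computes `annPathRun gas`);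
* **`sum_annPathRun_eq_sum_consG`**, `sum_pairOpt_eq_sum_consG`, **`annSetA_eq_sum_consG`**,
  **`annSetB_eq_sum_consG`** — the pair counts of `gas` as sums over pairs of `ConsG`-consistent
  guessed coin strings of `pairTermA`/`pairTermB` of the two total walks of `gas.map Prod.fst`;
* `tRunO_fst_eq` (the label of a walk depends only on the initial label), **`consG_iff_forall`** —
  consistency POSITIONALLY: for every oracle gate `t`, coin `t` is the indicator of its language on
  the query read off the label of the walk of the first `t` gates (the form a machine checks gate by
  gate: `AaronsonAmbainisThm23Atoms.lean`'s `orcT`/`coinT`/`qryF`).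

## References

* S. Aaronson, L. Chen, *Complexity-theoretic foundations of quantum supremacy experiments*,
  CCC 2017, §5.3 (pp. 22–23) [AaronsonChen2017].
* S. Aaronson, A. Ambainis, Theory Comput. 10 (2014), proof of Thm. 23 (arXiv:0911.0996v3, p. 14:
  counting guessed paths) [AaronsonAmbainis2014].
* E. Bernstein, U. Vazirani, SIAM J. Comput. 26 (1997), §8.3 (summing over paths of an oracle
  machine) [BernsteinVazirani1997].
* L. M. Adleman, J. DeMarrais, M.-D. A. Huang, SIAM J. Comput. 26 (1997), §6, Lemma 6.10
  [AdlemanDeMarraisHuang1997].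
-/

noncomputable section

namespace Literature.Computability.QuantumComplexity

open _root_.Computability Complexity Cryptography

namespace ADH

variable {N : ℕ}

/-! ### Annotating a gate list position by position -/

/-- **The gate list with gate `t` annotated by the language `As t`** (gate symbols carry an ignored
language). [cite: AaronsonChen2017, §5.3 (p. 22, the t-th O-gate replaced by g_t)] -/
def annotate : (ℕ → Language Bool) → List (QGate cliffordT N) → List (AnnGate N)
  | _, [] => []
  | As, g :: gs => (g, As 0) :: annotate (fun u => As (u + 1)) gs

/-- `annotate` on a cons (definitional). [folklore] -/
@[simp] theorem annotate_cons (As : ℕ → Language Bool) (g : QGate cliffordT N) (gs : List (QGate cliffordT N)) :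
    annotate As (g :: gs) = (g, As 0) :: annotate (fun u => As (u + 1)) gs := rfl

/-- `annotate` on the empty list. [folklore] -/
@[simp] theorem annotate_nil (As : ℕ → Language Bool) : annotate As ([] : List (QGate cliffordT N)) = [] := rfl

/-- Forgetting the annotations. [folklore] -/
@[simp] theorem map_fst_annotate : ∀ (As : ℕ → Language Bool) (gs : List (QGate cliffordT N)),
    (annotate As gs).map Prod.fst = gs
  | _, [] => rfl
  | As, g :: gs => by simp [map_fst_annotate _ gs]

/-- `annotate` keeps the length. [folklore] -/
@[simp] theorem length_annotate (As : ℕ → Language Bool) (gs : List (QGate cliffordT N)) :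
    (annotate As gs).length = gs.length := by
  rw [← List.length_map (f := Prod.fst), map_fst_annotate]

/-- The entries of `annotate`. [folklore] -/
theorem getElem?_annotate : ∀ (As : ℕ → Language Bool) (gs : List (QGate cliffordT N)) (t : ℕ),
    (annotate As gs)[t]? = (gs[t]?).map fun g => (g, As t)
  | _, [], t => by simp
  | As, g :: gs, 0 => by simp
  | As, g :: gs, t + 1 => by simp [getElem?_annotate _ gs t]

/-- `annotate` of a prefix is the prefix of `annotate`. [folklore] -/
theorem annotate_take : ∀ (As : ℕ → Language Bool) (gs : List (QGate cliffordT N)) (t : ℕ),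
    annotate As (gs.take t) = (annotate As gs).take t
  | _, [], t => by simp
  | As, g :: gs, 0 => by simp
  | As, g :: gs, t + 1 => by simp [annotate_take _ gs t]

/-- A constant annotation is the single-oracle annotation. [folklore] -/
theorem annotate_const (A : Language Bool) : ∀ gs : List (QGate cliffordT N),
    annotate (fun _ => A) gs = gs.map fun g => (g, A)
  | [] => rfl
  | g :: gs => by simp [annotate_const A gs]

/-! ### Consistency with the gates' own languages, and filling in their answers -/

/-- **All guesses are the answers of the gates' own languages**, along the walk. [cite: AaronsonChen2017, §5.3 (p. 23, "Analysis of the final circuit")] -/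
def ConsG : List (AnnGate N) → List Bool → QReg N → Prop
  | [], _, _ => True
  | (QGate.gate g e, _) :: gas, cs, w => ConsG gas cs.tail (lStepO (.gate g e) (headBit cs) w)
  | (QGate.oracle k e, A) :: gas, cs, w =>
      headBit cs = A.boolIndicator (queryOf e w) ∧ ConsG gas cs.tail (lStepO (.oracle k e) (headBit cs) w)

/-- **Filling in the own answers** at the oracle gates, along the walk. [folklore] -/
def fillG : List (AnnGate N) → List Bool → QReg N → List Bool
  | [], _, _ => []
  | (QGate.gate g e, _) :: gas, cs, w => headBit cs :: fillG gas cs.tail (lStepO (.gate g e) (headBit cs) w)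
  | (QGate.oracle k e, A) :: gas, cs, w =>
      A.boolIndicator (queryOf e w) :: fillG gas cs.tail (lStepO (.oracle k e) (A.boolIndicator (queryOf e w)) w)

/-- `fillG` gives one coin per gate. [folklore] -/
@[simp] theorem length_fillG : ∀ (gas : List (AnnGate N)) (cs : List Bool) (w : QReg N),
    (fillG gas cs w).length = gas.length
  | [], _, _ => rfl
  | (QGate.gate g e, _) :: gas, cs, w => by simp [fillG, length_fillG gas]
  | (QGate.oracle k e, A) :: gas, cs, w => by simp [fillG, length_fillG gas]

/-- **Filled coins are consistent.** [folklore] -/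
theorem consG_fillG : ∀ (gas : List (AnnGate N)) (cs : List Bool) (w : QReg N), ConsG gas (fillG gas cs w) w
  | [], _, _ => trivial
  | (QGate.gate g e, _) :: gas, cs, w => by
    simp only [fillG, ConsG, headBit_cons, List.tail_cons]
    exact consG_fillG gas cs.tail _
  | (QGate.oracle k e, A) :: gas, cs, w => by
    simp only [fillG, ConsG, headBit_cons, List.tail_cons, true_and]
    exact consG_fillG gas cs.tail _

/-- **Clearing the filled coins recovers the clear coins.** [folklore] -/
theorem clearO_fillG : ∀ (gas : List (AnnGate N)) (cs : List Bool) (w : QReg N),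
    IsClear (gas.map Prod.fst) cs → gas.length ≤ cs.length → clearO (gas.map Prod.fst) (fillG gas cs w) = cs.take gas.length
  | [], cs, _, _, _ => by simp [clearO]
  | ga :: gas, [], w, _, h => by simp at h
  | (QGate.gate g e, A) :: gas, c :: cs, w, hc, h => by
    simp only [List.map_cons, IsClear, headBit_cons, List.tail_cons, List.length_cons, Nat.add_le_add_iff_right] at hc h ⊢
    simp only [fillG, headBit_cons, List.tail_cons, clearO, isOracleB, Bool.not_false, Bool.and_true,
      List.take_succ_cons, clearO_fillG gas cs _ hc.2 h]
  | (QGate.oracle k e, A) :: gas, c :: cs, w, hc, h => by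
    simp only [List.map_cons, IsClear, headBit_cons, List.tail_cons, List.length_cons, Nat.add_le_add_iff_right] at hc h ⊢
    have hc0 : c = false := hc.1 rfl
    subst hc0
    simp only [fillG, List.tail_cons, clearO, headBit_cons, isOracleB, Bool.not_true, Bool.and_false,
      List.take_succ_cons, clearO_fillG gas cs _ hc.2 h]

/-- **Filling the cleared coins of a consistent walk recovers them.** [folklore] -/
theorem fillG_clearO : ∀ (gas : List (AnnGate N)) (cs : List Bool) (w : QReg N),
    ConsG gas cs w → gas.length ≤ cs.length → fillG gas (clearO (gas.map Prod.fst) cs) w = cs.take gas.length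
  | [], cs, _, _, _ => by simp [fillG]
  | ga :: gas, [], w, _, h => by simp at h
  | (QGate.gate g e, A) :: gas, c :: cs, w, hc, h => by
    simp only [List.length_cons, Nat.add_le_add_iff_right] at h
    have hc' : ConsG gas cs (lStepO (.gate g e) c w) := by simpa [ConsG] using hc
    simp only [List.map_cons, clearO, headBit_cons, isOracleB, Bool.not_false, Bool.and_true, List.tail_cons, fillG,
      List.length_cons, List.take_succ_cons, fillG_clearO gas cs _ hc' h]
  | (QGate.oracle k e, A) :: gas, c :: cs, w, hc, h => by
    simp only [List.length_cons, Nat.add_le_add_iff_right] at h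
    simp only [ConsG, headBit_cons, List.tail_cons] at hc
    have hhead : c = A.boolIndicator (queryOf e w) := hc.1
    have hc' : ConsG gas cs (lStepO (.oracle k e) c w) := hc.2
    simp only [List.map_cons, clearO, headBit_cons, isOracleB, Bool.not_true, Bool.and_false, List.tail_cons, fillG,
      List.length_cons, List.take_succ_cons, ← hhead, fillG_clearO gas cs _ hc' h]

/-! ### The guessed walk with the own answers computes the annotated path -/

/-- A non-clear coin list is not a path (an oracle gate admits no choice `1`). [folklore] -/
theorem annPathRun_eq_none_of_not_isClear' :
    ∀ (gas : List (AnnGate N)) (cs : List Bool) (w : QReg N), gas.length ≤ cs.length →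
      ¬ IsClear (gas.map Prod.fst) cs → annPathRun gas w (cs.take gas.length) = none
  | [], cs, w, _, h => absurd trivial h
  | ga :: gas, [], w, hl, _ => by simp at hl
  | ga :: gas, c :: cs, w, hl, h => by
    simp only [List.length_cons, Nat.add_le_add_iff_right] at hl
    simp only [List.map_cons, IsClear, headBit_cons, List.tail_cons, not_and_or, Classical.not_imp] at h
    simp only [List.length_cons, List.take_succ_cons, annPathRun]
    rcases h with ⟨ho, hc⟩ | h
    · obtain ⟨g, A⟩ := ga
      cases g with
      | gate op e => simp [isOracleB] at ho
      | oracle k e =>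
        have hc1 : c = true := by simpa using hc
        subst hc1
        simp [annPathStep]
    · rcases annPathStep ga c w with _ | ⟨w', φ⟩
      · rfl
      · simp only [annPathRun_eq_none_of_not_isClear' gas cs w' hl h, Option.map_none]

/-- **The guessed walk with the own answers filled in computes the annotated path**: from a valid
state, for clear coins (one per gate at least), if the path is valid with endpoint `z` and phase `ψ`
the walk ends at `(z, (φ + ψ) mod 8, valid)`, otherwise invalid.
[cite: AdlemanDeMarraisHuang1997, §6 Lemma 6.10 (proof, step 3)] [cite: AaronsonChen2017, §5.3 (p. 23)] -/
theorem tRunO_fillG_spec (gas : List (AnnGate N)) :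
    ∀ (cs : List Bool) (w : QReg N) (φ : ℕ), φ < 8 → gas.length ≤ cs.length → IsClear (gas.map Prod.fst) cs →
      match annPathRun gas w (cs.take gas.length) with
      | some (z, ψ) => tRunO (gas.map Prod.fst) (fillG gas cs w) (w, φ, true) = (z, (φ + ψ) % 8, true)
      | none => (tRunO (gas.map Prod.fst) (fillG gas cs w) (w, φ, true)).2.2 = false := by
  induction gas with
  | nil =>
    intro cs w φ hφ _ _
    simp [annPathRun, tRunO, Nat.mod_eq_of_lt hφ]
  | cons ga gas ih =>
    intro cs w φ hφ hlen hcl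
    cases cs with
    | nil => simp at hlen
    | cons c cs =>
      simp only [List.length_cons, Nat.add_le_add_iff_right] at hlen
      simp only [List.map_cons, IsClear, headBit_cons, List.tail_cons] at hcl
      obtain ⟨g, A⟩ := ga
      cases g with
      | gate op e =>
        simp only [List.map_cons, List.length_cons, List.take_succ_cons, annPathRun, annPathStep, fillG,
          headBit_cons, List.tail_cons, tRunO]
        rw [tStepO_true_gate]
        rcases hps : pathStep (.gate op e) c w with _ | ⟨w', ψ⟩
        · simp only
          have : lStepO (.gate op e) c w = (tStepO (.gate op e) c (w, φ, true)).1 := (tStepO_fst _ c w φ true).symm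
          rw [this]
          exact tRunO_false _ _ _ _
        · simp only
          have hw' : lStepO (.gate op e) c w = w' := by
            have h1 := tStepO_fst (.gate op e) c w φ true
            rw [tStepO_true_gate, hps] at h1
            exact h1.symm
          rw [hw']
          have h := ih cs w' ((φ + ψ) % 8) (Nat.mod_lt _ (by norm_num)) hlen hcl.2
          rcases hpr : annPathRun gas w' (cs.take gas.length) with _ | ⟨z, ψ'⟩
          · simp only [hpr, Option.map_none] at h ⊢
            exact h
          · simp only [hpr, Option.map_some] at h ⊢
            rw [h]
            simp only [Prod.mk.injEq, true_and, and_true]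
            rw [Nat.mod_add_mod, Nat.add_assoc]
      | oracle k e =>
        have hc0 : c = false := hcl.1 rfl
        subst hc0
        simp only [List.map_cons, List.length_cons, List.take_succ_cons, annPathRun, annPathStep, fillG,
          List.tail_cons, tRunO, headBit_cons, Bool.false_eq_true, ↓reduceIte]
        have hstep : tStepO (.oracle k e) (A.boolIndicator (queryOf e w)) (w, φ, true) = (oracleTarget A e w, φ, true) := by
          simp [tStepO, oracleTarget, Nat.mod_eq_of_lt hφ]
        have hl : lStepO (.oracle k e) (A.boolIndicator (queryOf e w)) w = oracleTarget A e w := by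
          rw [← tStepO_fst _ _ w φ true, hstep]
        rw [hstep, hl]
        have h := ih cs (oracleTarget A e w) φ hφ hlen hcl.2
        rcases hpr : annPathRun gas (oracleTarget A e w) (cs.take gas.length) with _ | ⟨z, ψ'⟩
        · simp only [hpr, Option.map_none] at h ⊢
          exact h
        · simp only [hpr, Option.map_some] at h ⊢
          rw [h]
          simp

/-! ### Sums over annotated paths as sums over consistent guessed paths -/

section Sums

variable (gas : List (AnnGate N)) (w : QReg N)

open scoped Classical in
/-- **Reindexing**: a sum over the paths of the annotated list of a function of (endpoint, phase
mod 8) vanishing on invalid paths equals the sum over the CONSISTENT guessed coin strings of the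
same function read off the guessed total walk of the underlying gate list.
[cite: AaronsonChen2017, §5.3 (p. 23, "all the computations can be done in PSPACE")] [cite: BernsteinVazirani1997, §8.3] -/
theorem sum_annPathRun_eq_sum_consG {R : Type*} [AddCommMonoid R] (G : Option (QReg N × ℕ) → R)
    (hG0 : G none = 0) (hG8 : ∀ z ψ, G (some (z, ψ)) = G (some (z, ψ % 8))) :
    ∑ b : Fin gas.length → Bool, G (annPathRun gas w (List.ofFn b)) =
      ∑ c : Fin gas.length → Bool,
        if ConsG gas (List.ofFn c) w then onValid G (tRunO (gas.map Prod.fst) (List.ofFn c) (w, 0, true)) else 0 := by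
  set n := gas.length with hn
  have hval : ∀ b : Fin n → Bool, IsClear (gas.map Prod.fst) (List.ofFn b) →
      G (annPathRun gas w (List.ofFn b)) = onValid G (tRunO (gas.map Prod.fst) (fillG gas (List.ofFn b) w) (w, 0, true)) := by
    intro b hb
    have h := tRunO_fillG_spec gas (List.ofFn b) w 0 (by norm_num) (by simp [hn]) hb
    rw [show (List.ofFn b).take gas.length = List.ofFn b from List.take_of_length_le (by simp [hn])] at h
    rcases hpr : annPathRun gas w (List.ofFn b) with _ | ⟨z, ψ⟩
    · simp only [hpr] at h
      rw [hG0, onValid, if_neg (by simp [h])]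
    · simp only [hpr] at h
      rw [onValid, h]
      simp [hG8 z ψ]
  have hclear : ∀ b : Fin n → Bool, G (annPathRun gas w (List.ofFn b)) ≠ 0 → IsClear (gas.map Prod.fst) (List.ofFn b) := by
    intro b hb
    by_contra h
    have := annPathRun_eq_none_of_not_isClear' gas (List.ofFn b) w (by simp [hn]) h
    rw [show (List.ofFn b).take gas.length = List.ofFn b from List.take_of_length_le (by simp [hn])] at this
    exact hb (by rw [this, hG0])
  have hlen : (gas.map Prod.fst).length = n := by simp [hn]
  refine Finset.sum_bij_ne_zero (fun b _ _ => toFn n (fillG gas (List.ofFn b) w)) (fun b _ _ => Finset.mem_univ _)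
    ?_ ?_ ?_
  · -- injective
    intro b₁ _ h₁ b₂ _ h₂ heq
    have hc₁ := hclear b₁ h₁
    have hc₂ := hclear b₂ h₂
    have heq' : fillG gas (List.ofFn b₁) w = fillG gas (List.ofFn b₂) w := by
      rw [← ofFn_toFn (length_fillG gas (List.ofFn b₁) w), heq, ofFn_toFn (length_fillG gas (List.ofFn b₂) w)]
    have h1 := clearO_fillG gas (List.ofFn b₁) w hc₁ (by simp [hn])
    have h2 := clearO_fillG gas (List.ofFn b₂) w hc₂ (by simp [hn])
    rw [List.take_of_length_le (by simp [hn])] at h1 h2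
    exact List.ofFn_injective (h1.symm.trans (heq' ▸ h2))
  · -- surjective
    intro c _ hc
    have hcons : ConsG gas (List.ofFn c) w := by
      by_contra h; rw [if_neg h] at hc; exact hc rfl
    refine ⟨toFn n (clearO (gas.map Prod.fst) (List.ofFn c)), Finset.mem_univ _, ?_, ?_⟩
    · rw [hval _ (by rw [ofFn_toFn ((length_clearO _ _).trans hlen)]; exact isClear_clearO _ _),
        ofFn_toFn ((length_clearO _ _).trans hlen), fillG_clearO gas (List.ofFn c) w hcons (by simp [hn]),
        List.take_of_length_le (by simp [hn])]
      rwa [if_pos hcons] at hc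
    · rw [ofFn_toFn ((length_clearO _ _).trans hlen), fillG_clearO gas (List.ofFn c) w hcons (by simp [hn]),
        List.take_of_length_le (by simp [hn]), toFn_ofFn]
  · -- values
    intro b _ hb
    have hcl := hclear b hb
    rw [hval b hcl, ofFn_toFn (length_fillG gas _ w), if_pos (consG_fillG gas _ w)]

open scoped Classical in
/-- **The pair counts as sums over consistent guessed pairs** (generic in the class weight `f`).
[cite: AaronsonChen2017, §5.3 (p. 23)] [cite: AdlemanDeMarraisHuang1997, §6 Lemma 6.10] -/
theorem sum_pairOpt_eq_sum_consG (f : ℕ → ℤ) (S : Set (QReg N)) :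
    ∑ b : Fin gas.length → Bool, ∑ b' : Fin gas.length → Bool,
        pairOpt f S (annPathRun gas w (List.ofFn b)) (annPathRun gas w (List.ofFn b')) =
      ∑ c : Fin gas.length → Bool, ∑ c' : Fin gas.length → Bool,
        if ConsG gas (List.ofFn c) w ∧ ConsG gas (List.ofFn c') w then
          (let s := tRunO (gas.map Prod.fst) (List.ofFn c) (w, 0, true); let s' := tRunO (gas.map Prod.fst) (List.ofFn c') (w, 0, true)
           if s.2.2 = true ∧ s'.2.2 = true ∧ s.1 = s'.1 ∧ s.1 ∈ S then f ((s.2.1 + 7 * s'.2.1) % 8) else 0)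
        else 0 := by
  -- inner sums: reindex `b'` for fixed `b`
  have hinner : ∀ o : Option (QReg N × ℕ),
      ∑ b' : Fin gas.length → Bool, pairOpt f S o (annPathRun gas w (List.ofFn b')) =
        ∑ c' : Fin gas.length → Bool, if ConsG gas (List.ofFn c') w then
          onValid (pairOpt f S o) (tRunO (gas.map Prod.fst) (List.ofFn c') (w, 0, true)) else 0 := by
    intro o
    refine sum_annPathRun_eq_sum_consG (R := ℤ) gas w (pairOpt f S o) ?_ ?_
    · cases o with
      | none => rfl
      | some p => rfl
    · intro z ψ
      cases o with
      | none => rfl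
      | some p =>
        obtain ⟨z₁, φ⟩ := p
        simp only [pairOpt, (pairClass_mod φ ψ).2]
  simp_rw [hinner]
  rw [Finset.sum_comm]
  -- outer sums: reindex `b` for fixed `c'`
  have houter : ∀ c' : Fin gas.length → Bool,
      ∑ b : Fin gas.length → Bool, (if ConsG gas (List.ofFn c') w then
          onValid (pairOpt f S (annPathRun gas w (List.ofFn b))) (tRunO (gas.map Prod.fst) (List.ofFn c') (w, 0, true)) else 0) =
        ∑ c : Fin gas.length → Bool, if ConsG gas (List.ofFn c) w then
          onValid (fun o => if ConsG gas (List.ofFn c') w then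
            onValid (pairOpt f S o) (tRunO (gas.map Prod.fst) (List.ofFn c') (w, 0, true)) else 0)
            (tRunO (gas.map Prod.fst) (List.ofFn c) (w, 0, true)) else 0 := by
    intro c'
    set G : Option (QReg N × ℕ) → ℤ := fun o => if ConsG gas (List.ofFn c') w then
        onValid (pairOpt f S o) (tRunO (gas.map Prod.fst) (List.ofFn c') (w, 0, true)) else 0 with hG
    have h0 : G none = 0 := by simp [hG, onValid, pairOpt]
    have h8 : ∀ z ψ, G (some (z, ψ)) = G (some (z, ψ % 8)) := by
      intro z ψ
      by_cases hc : ConsG gas (List.ofFn c') w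
      · simp only [hG, if_pos hc, onValid, pairOpt, (pairClass_mod ψ _).1]
      · simp only [hG, if_neg hc]
    exact sum_annPathRun_eq_sum_consG (R := ℤ) gas w G h0 h8
  simp_rw [houter]
  rw [Finset.sum_comm]
  refine Finset.sum_congr rfl fun c _ => Finset.sum_congr rfl fun c' _ => ?_
  by_cases hc : ConsG gas (List.ofFn c) w <;> by_cases hc' : ConsG gas (List.ofFn c') w <;>
    simp only [hc, hc', if_true, if_false, and_true, and_false, onValid, pairOpt]
  · rcases tRunO (gas.map Prod.fst) (List.ofFn c) (w, 0, true) with ⟨z, ph, v⟩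
    rcases tRunO (gas.map Prod.fst) (List.ofFn c') (w, 0, true) with ⟨z', ph', v'⟩
    cases v <;> cases v' <;> simp
  · rcases tRunO (gas.map Prod.fst) (List.ofFn c) (w, 0, true) with ⟨z, ph, v⟩
    cases v <;> simp

open scoped Classical in
/-- **`annSetA` of an annotated list is the sum of `pairTermA` over pairs of consistent guessed coin
strings.** [cite: AaronsonChen2017, §5.3 (p. 23)] [cite: AdlemanDeMarraisHuang1997, §6 Lemma 6.10] -/
theorem annSetA_eq_sum_consG (S : Set (QReg N)) :
    annSetA gas w S =
      ∑ c : Fin gas.length → Bool, ∑ c' : Fin gas.length → Bool,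
        if ConsG gas (List.ofFn c) w ∧ ConsG gas (List.ofFn c') w then
          pairTermA S (tRunO (gas.map Prod.fst) (List.ofFn c) (w, 0, true)) (tRunO (gas.map Prod.fst) (List.ofFn c') (w, 0, true))
        else 0 := by
  have h1 : annSetA gas w S =
      ∑ b : Fin gas.length → Bool, ∑ b' : Fin gas.length → Bool,
        pairOpt reA S (annPathRun gas w (List.ofFn b)) (annPathRun gas w (List.ofFn b')) := by
    unfold annSetA
    refine Finset.sum_congr rfl fun b _ => Finset.sum_congr rfl fun b' _ => ?_
    unfold pairOpt
    rcases annPathRun gas w (List.ofFn b) with _ | ⟨z₁, φ⟩ <;> rcases annPathRun gas w (List.ofFn b') with _ | ⟨z₂, φ'⟩ <;> rfl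
  rw [h1, sum_pairOpt_eq_sum_consG]
  rfl

open scoped Classical in
/-- **`annSetB` of an annotated list is the sum of `pairTermB` over pairs of consistent guessed coin
strings.** [cite: AaronsonChen2017, §5.3 (p. 23)] [cite: AdlemanDeMarraisHuang1997, §6 Lemma 6.10] -/
theorem annSetB_eq_sum_consG (S : Set (QReg N)) :
    annSetB gas w S =
      ∑ c : Fin gas.length → Bool, ∑ c' : Fin gas.length → Bool,
        if ConsG gas (List.ofFn c) w ∧ ConsG gas (List.ofFn c') w then
          pairTermB S (tRunO (gas.map Prod.fst) (List.ofFn c) (w, 0, true)) (tRunO (gas.map Prod.fst) (List.ofFn c') (w, 0, true))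
        else 0 := by
  have h1 : annSetB gas w S =
      ∑ b : Fin gas.length → Bool, ∑ b' : Fin gas.length → Bool,
        pairOpt reB S (annPathRun gas w (List.ofFn b)) (annPathRun gas w (List.ofFn b')) := by
    unfold annSetB
    refine Finset.sum_congr rfl fun b _ => Finset.sum_congr rfl fun b' _ => ?_
    unfold pairOpt
    rcases annPathRun gas w (List.ofFn b) with _ | ⟨z₁, φ⟩ <;> rcases annPathRun gas w (List.ofFn b') with _ | ⟨z₂, φ'⟩ <;> rfl
  rw [h1, sum_pairOpt_eq_sum_consG]
  rfl

end Sums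

/-! ### Consistency, positionally -/

/-- `headBit` reads position `0` (twin of `AaronsonAmbainisThm23Atoms.headBit_eq_getD`, not importable
here without its machine files). [folklore] -/
theorem headBit_eq_getD0 (cs : List Bool) : headBit cs = cs.getD 0 false := by
  cases cs <;> simp

/-- Positions of the tail (twin of `AaronsonAmbainisThm23Atoms.getD_tail` and `BMMachine.getD_tail`, neither
importable here without unrelated machine files). [folklore] -/
theorem getD_tail_succ (cs : List Bool) (t : ℕ) : cs.tail.getD t false = cs.getD (t + 1) false := by
  cases cs <;> simp

/-- **The label of a guessed walk depends only on the initial label** (not on phase or flag). [folklore] -/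
theorem tRunO_fst_eq : ∀ (gs : List (QGate cliffordT N)) (cs : List Bool) (s s' : TState N),
    s.1 = s'.1 → (tRunO gs cs s).1 = (tRunO gs cs s').1
  | [], _, _, _, h => h
  | g :: gs, cs, ⟨w, φ, v⟩, ⟨w', φ', v'⟩, h => by
    simp only at h
    subst h
    simp only [tRunO]
    refine tRunO_fst_eq gs _ _ _ ?_
    rw [tStepO_fst, tStepO_fst]

/-- The label after one more gate. [folklore] -/
theorem tRunO_take_succ_fst (gs : List (QGate cliffordT N)) (cs : List Bool) (w : QReg N) {t : ℕ} {g : QGate cliffordT N}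
    (hg : gs[t]? = some g) :
    (tRunO (gs.take (t + 1)) cs (w, 0, true)).1 = lStepO g (cs.getD t false) (tRunO (gs.take t) cs (w, 0, true)).1 := by
  induction gs generalizing cs w t with
  | nil => simp at hg
  | cons g₀ gs ih =>
    cases t with
    | zero =>
      simp only [List.getElem?_cons_zero, Option.some.injEq] at hg
      subst hg
      simp only [zero_add, List.take_succ_cons, List.take_zero, tRunO]
      rw [tStepO_fst, headBit_eq_getD0]
    | succ t =>
      simp only [List.getElem?_cons_succ] at hg
      simp only [List.take_succ_cons, tRunO]
      rw [tRunO_fst_eq (gs.take (t + 1)) cs.tail (tStepO g₀ (headBit cs) (w, 0, true)) ((tStepO g₀ (headBit cs) (w, 0, true)).1, 0, true) rfl,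
        tRunO_fst_eq (gs.take t) cs.tail (tStepO g₀ (headBit cs) (w, 0, true)) ((tStepO g₀ (headBit cs) (w, 0, true)).1, 0, true) rfl,
        ih cs.tail _ hg, getD_tail_succ]

/-- **Consistency, positionally**: the coins are consistent with the annotated list iff for every
oracle gate `t` the coin `t` is the indicator of ITS language on the query read off the label of the
walk of the first `t` gates. [cite: AaronsonChen2017, §5.3 (p. 23)] [cite: AaronsonAmbainis2014, proof of Thm. 23 (p. 14)] -/
theorem consG_iff_forall : ∀ (gas : List (AnnGate N)) (cs : List Bool) (w : QReg N),
    ConsG gas cs w ↔ ∀ (t k : ℕ) (e : Fin (k + 1) ↪ Fin N) (A : Language Bool),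
      gas[t]? = some (QGate.oracle k e, A) →
        cs.getD t false = A.boolIndicator (queryOf e (tRunO ((gas.map Prod.fst).take t) cs (w, 0, true)).1)
  | [], cs, w => by simp [ConsG]
  | (g, A₀) :: gas, cs, w => by
    -- the tail condition, shifted by one position
    have htail : ∀ c : Bool, (ConsG gas cs.tail (lStepO g c w) ↔
        ∀ (t k : ℕ) (e : Fin (k + 1) ↪ Fin N) (A : Language Bool), gas[t]? = some (QGate.oracle k e, A) →
          cs.tail.getD t false = A.boolIndicator (queryOf e (tRunO ((gas.map Prod.fst).take t) cs.tail (lStepO g c w, 0, true)).1)) :=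
      fun c => consG_iff_forall gas cs.tail (lStepO g c w)
    have hshift : ∀ (t : ℕ), (tRunO (((g, A₀) :: gas).map Prod.fst |>.take (t + 1)) cs (w, 0, true)).1 =
        (tRunO ((gas.map Prod.fst).take t) cs.tail (lStepO g (headBit cs) w, 0, true)).1 := by
      intro t
      simp only [List.map_cons, List.take_succ_cons, tRunO]
      exact tRunO_fst_eq _ _ _ _ (tStepO_fst g (headBit cs) w 0 true)
    cases g with
    | gate op e =>
      simp only [ConsG]
      rw [htail]
      constructor
      · intro h t k e' A hg
        cases t with
        | zero => simp at hg
        | succ t =>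
          simp only [List.getElem?_cons_succ] at hg
          rw [← getD_tail_succ, hshift t]
          exact h t k e' A hg
      · intro h t k e' A hg
        have h' := h (t + 1) k e' A (by simpa using hg)
        rw [← getD_tail_succ, hshift t] at h'
        exact h'
    | oracle k₀ e₀ =>
      simp only [ConsG]
      rw [htail]
      constructor
      · rintro ⟨h0, h⟩ t k e' A hg
        cases t with
        | zero =>
          simp only [List.getElem?_cons_zero, Option.some.injEq, Prod.mk.injEq, QGate.oracle.injEq] at hg
          obtain ⟨⟨rfl, he⟩, rfl⟩ := hg
          have he' : e₀ = e' := eq_of_heq he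
          subst he'
          rw [← headBit_eq_getD0, h0]
          simp [tRunO]
        | succ t =>
          simp only [List.getElem?_cons_succ] at hg
          rw [← getD_tail_succ, hshift t]
          exact h t k e' A hg
      · intro h
        refine ⟨?_, fun t k e' A hg => ?_⟩
        · have h' := h 0 k₀ e₀ A₀ (by simp)
          rw [← headBit_eq_getD0] at h'
          simpa [tRunO] using h'
        · have h' := h (t + 1) k e' A (by simpa using hg)
          rw [← getD_tail_succ, hshift t] at h'
          exact h'

end ADH

end Literature.Computability.QuantumComplexity

end
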